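import Summits.HodgeConjecture.HodgeConjecture.Theorems.HLiu418S1BettiSliceExclusion
import Summits.HodgeConjecture.HodgeConjecture.Theorems.HLiu418CurveHodgeTypesDisjoint
import Literature.NumberTheory.Automorphic.UnitaryCurveCotangentSpectralProjectionHerm
import Literature.NumberTheory.Rogawski1990.CurveThetaHodgeTypeSigned
import Literature.NumberTheory.Automorphic.IdeleClassCharacterConjugate
import HarnessLib

/-!
# Crux `HLiu418`, line `F0_AlbCm` ∕ sub-sub-line `F0_AlbCmS1Betti` — the EXCLUSION STUB (X) FOLDED onto the SIGNED letters E3₂♮ instead of E2′₂θ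
# (debt reduction: `curveThetaHodgeTypeRigid` at the crux label is a corollary of `curveThetaHodgeTypeSigned_hol ∕ _antihol`)

Floor-0 programme P5 (Alb-CM), seat F0P5-p04 (g2) (the sign seat); crux item stmt-HodgeConjecture-24832 (`HCCMUnconditional.HLiu418`).  THEOREMS ONLY, def-free,
`sorry`-free; named-fact inputs are HYPOTHESES BY THEIR LITERATURE NAMES.  HC_CM is proved only modulo the 7 printed citations until rung 0 closes.

WHY.  After the ROAD (A) twins (★ `F0AlbCmS1bHodgeHolds`, `F0AlbCmS1BettiHolds`) the parent line `Cruxes/HLiu418/Lines/F0_AlbCm.lean` carries the union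
roster of named-fact stubs {E1, E1′hol, E2′, TPhol, E₂hol, E3hol, E3antihol}.  The sign-free letter E2′ ★ `Rogawski1990.curveThetaHodgeTypeRigid` («a theta
`σ ↪ ω(χₕ, ε_a, χ)_f` is not the finite component of both a `(1,0)`- and a `(0,1)`-type discrete `P`», for EVERY unitary splitting character `χₕ`) is consumed
at exactly one place, ★ `S1BettiSliceExclusion.stub_X_of_letters` (F0P5-p03, p798893-era), and there at the crux label `χₕ := toHeckeCharacter F (galConj c μ)`,
which is CONJUGATE SYMPLECTIC (★ `IsConjugateSymplectic.galConj`) of WEIGHT ONE (★ `HasWeight.galConj_complexConj`) — the binder class of the SIGNED letters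
E3₂♮ ★ `Rogawski1990.curveThetaHodgeTypeSigned_hol ∕ _antihol` ([Liu2021, Rem. D.5]; F0P5-p02, p795029).  At such a label the two signed letters give
`(e♮ ∈ Φ_λ ↔ ε_a admissible)` from a holomorphic occurrence and `(e♮ ∈ Φ_λ ↔ ¬ ε_a admissible)` from an antiholomorphic one, so both cannot occur:
E2′-at-the-label is a COROLLARY of E3 (the general E2′ is not — weight one is essential — hence no Literature restatement; the fold is Summits-side).
`stub_X_of_signed_letters` is p03's (X) fold with that last step replaced; everything else (anisotropy ⇒ compact quotient and discrete `L²`, `ω⋆_lab`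
irreducible-or-zero and smooth, the scalar spectral junction J1′₂ twice, TP⁺ twice) is p03's ★ proof over p03's ★ helpers BY IMPORT.
Downstream: `Theorems/HLiu418S1MultOneFormsOfSignedLetters` (waist over (X♮)) and `stub_S1_betti_holds_signed`; parent edition
`stub_S1_betti := … stub_E1 stub_E1'hol stub_E3hol stub_E3antihol stub_TPhol stub_E₂hol`, `stub_E2'` deleted (named-fact stubs 7 → 6).

## References
* [Liu2021] Y. Liu, *Fourier–Jacobi cycles and arithmetic relative trace formula*, Camb. J. Math. 9 (2021): Rem. D.5 (p. 131); Prop. D.4 (1)–(2) and proof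
  (p. 130–131); Lem. D.1; Def. 4.11–4.12.
* [Rogawski1990] J. Rogawski, *Automorphic representations of unitary groups in three variables*, Ann. of Math. Stud. 123, §11 (Prop. 11.1.1, 11.2.1, Thm. 11.5.1).
* [BorelJacquet1979] A. Borel, H. Jacquet, *Automorphic forms and automorphic representations*, PSPM 33.1, §4.6.  [Borel1997] §5.14, Thm. 2.13.
-/

-- ED. 2 (ROAD (i′) PHASE B, F0P5-plan 02:30:56Z): the two TP₂ letter applications go through ★ `….apply_herm` (F0P5-p03 (g2), p803625) at the
-- hermitian `σ_{w₁}J⋆` supplied by ★ `CurveHodgeTypesDisjoint.isHermitian_map_of_formCongr` from `hτt'`; statements byte-identical to ED. 1 (p800694).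
set_option autoImplicit false
-- the mandated namespace repeats `HodgeConjecture.HodgeConjecture`, as in every `Theorems/*.lean` of this sub-problem
set_option linter.dupNamespace false

noncomputable section

namespace Summit.HodgeConjecture.HodgeConjecture.Cruxes.HLiu418.S1BettiSliceExclusionSigned

open scoped TensorProduct Matrix NumberField Kronecker ComplexOrder InnerProductSpace ENNReal
open MeasureTheory
open NumberField NumberField.InfinitePlace IsDedekindDomain
open Summit.HodgeConjecture.CorCM.Model Summit.HodgeConjecture.CorCM.Model.HComp Summit.HodgeConjecture.CorCM.HComp
open Literature.AlgebraicGeometry.Motives (CMType AbelianVariety)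
open Literature.AlgebraicGeometry.ShimuraVarieties Literature.AlgebraicGeometry.ShimuraVarieties.UnitaryCanonicalModel
open Literature.NumberTheory.Automorphic Literature.NumberTheory.Automorphic.UnitaryGroup Literature.NumberTheory.Automorphic.UnitaryCurveForms
open Literature.NumberTheory.Automorphic.UnitaryGroup.CotangentForms (toQuotFun toQuotFun_mk)
open Literature.NumberTheory.Automorphic.IdeleClassGroup Literature.NumberTheory.Automorphic.Liu2021 Literature.NumberTheory.Automorphic.Liu2021.AppendixC
open Literature.NumberTheory.GaloisRepresentations Literature.RepresentationTheory.Liu2021 Literature.RepresentationTheory.HarrisKudlaSweet1996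
open Literature.AlgebraicGeometry.Liu2021 (IsAdmissibleElement)
open Literature.NumberTheory.Weil1964 Literature.NumberTheory.GelbartRogawski1991 Literature.NumberTheory.GelbartRogawski1991.UnitaryDualPair Literature.NumberTheory.GelbartRogawski1991.UnitaryDualPair.WeilCoinv
open Literature.NumberTheory.GelbartRogawski1991.UnitaryDualPair.LocalSplitting
open Literature.NumberTheory.Automorphic.Liu2021.Def411WeilCarriersDoubling
open Literature.NumberTheory.Automorphic.Liu2021.Def411WeilCarriers (TW JW JW_eq isSymm_TW isUnit_det_TW Rep Eps epsOf Chi rhoVAtLine rhoAtLine omegaAtLine)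
open Summit.HodgeConjecture.CorCM (CMField)
open Summit.HodgeConjecture.CorCM.Lines.A3Liu418
open Summit.HodgeConjecture.HodgeConjecture.Cruxes.H413.F0P3HilbertProjection
open Summit.HodgeConjecture.HodgeConjecture.Cruxes.H413.SpectrumJunction
open Summit.HodgeConjecture.HodgeConjecture.Cruxes.HLiu418.ScalarSpectralJunction
open Summit.HodgeConjecture.HodgeConjecture.Cruxes.HLiu418.S1BettiSliceExclusion

set_option synthInstance.maxHeartbeats 400000 in
set_option maxHeartbeats 4000000 in  -- both as the E2′ original (★ `stub_X_of_letters`): the `ω⋆_lab` term is elaborated many times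
/-- **THE (X) FOLD ON THE SIGNED LETTERS — `S1ExclusionShape` from E3₂♮ `curveThetaHodgeTypeSigned_hol ∕ _antihol` (★ p795029, BY NAME) INSTEAD OF the
sign-free E2′₂θ `curveThetaHodgeTypeRigid`, plus TP⁺ (`hTPhol` ∕ `hTPantihol`, ★) and the ★ continuity of holomorphic curve cotangent forms.**  Same conclusion as ★
`S1BettiSliceExclusion.stub_X_of_letters` (F0P5-p03), TOKEN FOR TOKEN (= the TYPE of the sub-sub-line's `stub_X : S1ExclusionShape`); same proof over the same ★
helpers up to the last step, where E2′ was applied at the ONE label `χₕ := toHeckeCharacter F (galConj c μ)` — a conjugate-symplectic splitting (★ `hμ.galConj`) of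
weight one (★ `HasWeight.galConj_complexConj`), i.e. inside the binder class of the signed letters: the `(1,0)` occurrence gives `e♮ ∈ Φ_λ ↔ ε admissible`, the
`(0,1)` occurrence gives `e♮ ∈ Φ_λ ↔ ¬ ε admissible`, contradiction.  EFFECT: the parent's named-fact stub `stub_E2'` becomes derivable from `stub_E3hol` ∕
`stub_E3antihol` (roster 7 → 6).  HC_CM is proved only modulo the 7 printed citations until rung 0 closes.
[cite: Liu2021, Rem. D.5 (p. 131); Prop. D.4 (1)–(2) and proof (p. 130–131)] [cite: Rogawski1990, §11.1 Prop. 11.1.1; Prop. 11.2.1 (b); Thm. 11.5.1 (b)]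
[cite: BorelJacquet1979, §4.6] -/
theorem stub_X_of_signed_letters (hE3hol : Literature.NumberTheory.Rogawski1990.curveThetaHodgeTypeSigned_hol)
    (hE3antihol : Literature.NumberTheory.Rogawski1990.curveThetaHodgeTypeSigned_antihol)
    (hTPhol : Literature.NumberTheory.Automorphic.UnitaryCurveForms.holCotFormSpectralProjection₂)
    (hTPantihol : Literature.NumberTheory.Automorphic.UnitaryCurveForms.antiholCotFormSpectralProjection₂) :
      ∀ (F : CMField) [IsGalois ℚ F] (ι₁ : F →+* ℂ)
        (μ : Literature.NumberTheory.Automorphic.IdeleClassGroup (F : Type) →ₜ* Circle)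
        (hμ : IdeleClassGroup.IsConjugateSymplectic (F : Type) μ)
        (_hw : IdeleClassGroup.HasWeight (F : Type) μ 1)
        (Jstar : Matrix (Fin 2) (Fin 2) (F : Type)) (t : (F : Type)) (ht : t ≠ 0) (_hτt : 0 < (ι₁ t).re) (_hτt' : (ι₁ t).im = 0)
        (gstar : GL (Fin 2) (F : Type))
        (dJ : Fin 2 → (F : Type)) (hdJ : ∀ i, IsCMField.complexConj (F : Type) (dJ i) = dJ i) (hdJ0 : ∀ i, dJ i ≠ 0)
        (hg : formCongr ((IsCMField.complexConj (F : Type) : (F : Type) ≃ₐ[↥(maximalRealSubfield (F : Type))] (F : Type)) :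
            (F : Type) →+* (F : Type)) gstar (t • Jstar) = Matrix.diagonal dJ)
        (_hsig : (∃ Tstar : GL (Fin 2) ℂ,
            formCongr (starRingEnd ℂ) Tstar ((Matrix.diagonal dJ).map ι₁) = Matrix.diagonal ![(1 : ℂ), -1]) ∧
          ∀ τ' : (F : Type) →+* ℂ, InfinitePlace.mk τ' ≠ InfinitePlace.mk ι₁ → ((Matrix.diagonal dJ).map τ').PosDef)
        (h4 : 4 ≤ Module.finrank ℚ (F : Type))
        (r : Rep ↥(maximalRealSubfield (F : Type)) (imagUnitSq F))
        (ε : Eps ↥(maximalRealSubfield (F : Type)) (imagUnitSq F))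
        (_hadm : ∃ e : (F : Type), IsAdmissibleElement (F : Type) hμ.cmType.1 e ∧
          epsOf ↥(maximalRealSubfield (F : Type)) (imagUnitSq F) (F : Type) (2 * imagUnit (F : Type))⁻¹ (-e) = ε)
        (χ : Chi ↥(maximalRealSubfield (F : Type)) (F : Type) (IsCMField.complexConj (F : Type)))
        (𝔣 : ConeFrame (F : Type) Jstar (cmPlace (F : Type) ι₁)),
        (∀ ψ : Representation.IntertwiningMap
            ((rhoVAtLine ↥(maximalRealSubfield (F : Type)) (F : Type) (IsCMField.complexConj (F : Type)) 2
              (finProdFinEquiv : Fin 2 × Fin 1 ≃ Fin (2 * 1)) (Matrix.diagonal dJ)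
              (complexConj_imagUnit F) (imagUnit_ne_zero F) (imagUnit_mul_self F) (realDiagonal_isSymm F dJ hdJ)
              (isUnit_det_realDiagonal F dJ hdJ hdJ0) (realDiagonal_map F dJ hdJ).symm
              (hsChiGS F finProdFinEquiv dJ hdJ hdJ0
                (toHeckeCharacter (F : Type) (galConj (IsCMField.complexConj (F : Type)) μ))
                (isUnitary_toHeckeCharacter (F : Type) (galConj (IsCMField.complexConj (F : Type)) μ))
                ((isOscillatorChar_toHeckeCharacter_iff (galConj (IsCMField.complexConj (F : Type)) μ)).mpr hμ.galConj))
              (r.toFun ε) χ).comp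
              (finAdelicCongr ↥(maximalRealSubfield (F : Type)) (F : Type) (IsCMField.complexConj (F : Type)) gstar ht hg).symm.toMonoidHom)
            (rightRep₂ ↥(maximalRealSubfield (F : Type)) (F : Type) (IsCMField.complexConj (F : Type)) Jstar),
          (∀ w, ψ w ∈ holCotForms₂ ↥(maximalRealSubfield (F : Type)) (F : Type) (IsCMField.complexConj (F : Type)) Jstar
              (IsCMField.complexConj_ne_one (F : Type)) (UnitaryGroup.complexConj_smul_infinitePlace (F : Type))
              (cmPlace (F : Type) ι₁) 𝔣) → ψ = 0) ∨
        (∀ ψ : Representation.IntertwiningMap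
            ((rhoVAtLine ↥(maximalRealSubfield (F : Type)) (F : Type) (IsCMField.complexConj (F : Type)) 2
              (finProdFinEquiv : Fin 2 × Fin 1 ≃ Fin (2 * 1)) (Matrix.diagonal dJ)
              (complexConj_imagUnit F) (imagUnit_ne_zero F) (imagUnit_mul_self F) (realDiagonal_isSymm F dJ hdJ)
              (isUnit_det_realDiagonal F dJ hdJ hdJ0) (realDiagonal_map F dJ hdJ).symm
              (hsChiGS F finProdFinEquiv dJ hdJ hdJ0
                (toHeckeCharacter (F : Type) (galConj (IsCMField.complexConj (F : Type)) μ))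
                (isUnitary_toHeckeCharacter (F : Type) (galConj (IsCMField.complexConj (F : Type)) μ))
                ((isOscillatorChar_toHeckeCharacter_iff (galConj (IsCMField.complexConj (F : Type)) μ)).mpr hμ.galConj))
              (r.toFun ε) χ).comp
              (finAdelicCongr ↥(maximalRealSubfield (F : Type)) (F : Type) (IsCMField.complexConj (F : Type)) gstar ht hg).symm.toMonoidHom)
            (rightRep₂ ↥(maximalRealSubfield (F : Type)) (F : Type) (IsCMField.complexConj (F : Type)) Jstar),
          (∀ w, ψ w ∈ (holCotForms₂ ↥(maximalRealSubfield (F : Type)) (F : Type) (IsCMField.complexConj (F : Type)) Jstar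
              (IsCMField.complexConj_ne_one (F : Type)) (UnitaryGroup.complexConj_smul_infinitePlace (F : Type))
              (cmPlace (F : Type) ι₁) 𝔣).map (conjFun₂ ↥(maximalRealSubfield (F : Type)) (F : Type) (IsCMField.complexConj (F : Type)) Jstar)) → ψ = 0) := by
  intro F _ ι₁ μ hμ hw Jstar t ht hτt hτt' gstar dJ hdJ hdJ0 hg hsig h4 r ε hadm χ 𝔣
  by_contra hcon
  rw [not_or] at hcon
  obtain ⟨hA, hB⟩ := hcon
  push Not at hA hB
  obtain ⟨ψ, hψv, hψ0⟩ := hA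
  obtain ⟨ψ', hψ'v, hψ'0⟩ := hB
  -- `J⋆` anisotropic ⇒ an automorphic measure with COMPACT quotient and discretely decomposable `L²`
  obtain ⟨τ, hτ⟩ := UnitaryGroup.exists_infinitePlace_ne (F : Type) h4 ι₁
  have hanis := anisotropic_of_formCongr_posDef (F : Type) Jstar t gstar dJ hg τ (hsig.2 τ hτ)
  obtain ⟨μA, hμA, hdisc⟩ :=
    UnitaryGroup.exists_isAutomorphicMeasure_isDiscretelyDecomposable_adelicGroupData (F : Type) 2 Jstar hanis
  haveI := hμA
  haveI : CompactSpace (adelicGroupData ↥(maximalRealSubfield (F : Type)) (F : Type) (IsCMField.complexConj (F : Type)) 2 Jstar).automorphicQuotient :=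
    UnitaryGroup.compactSpace_cmDatum_automorphicQuotient (F : Type) 2 Jstar hanis
  -- `ω⋆_lab ≠ 0` (as `ψ ≠ 0`), hence irreducible (★ irreducible-or-zero), and smooth (★)
  obtain ⟨w₁, hw₁⟩ : ∃ w, ψ w ≠ 0 := by
    by_contra h
    push Not at h
    exact hψ0 (Representation.IntertwiningMap.ext (LinearMap.ext h))
  haveI hnt : Nontrivial _ := ⟨⟨w₁, 0, fun h => hw₁ (by rw [h, map_zero])⟩⟩
  have hirr := (subsingleton_or_isIrreducible_omegaStarGS F dJ hdJ hdJ0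
    (toHeckeCharacter (F : Type) (galConj (IsCMField.complexConj (F : Type)) μ))
    (isUnitary_toHeckeCharacter (F : Type) (galConj (IsCMField.complexConj (F : Type)) μ))
    ((isOscillatorChar_toHeckeCharacter_iff (galConj (IsCMField.complexConj (F : Type)) μ)).mpr hμ.galConj)
    (r.toFun ε) χ ht gstar hg).resolve_left (not_subsingleton _)
  have hsmR := isSmoothRep_omegaStarGS F dJ hdJ hdJ0
    (toHeckeCharacter (F : Type) (galConj (IsCMField.complexConj (F : Type)) μ))
    (isUnitary_toHeckeCharacter (F : Type) (galConj (IsCMField.complexConj (F : Type)) μ))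
    ((isOscillatorChar_toHeckeCharacter_iff (galConj (IsCMField.complexConj (F : Type)) μ)).mpr hμ.galConj)
    (r.toFun ε) χ ht gstar hg
  have hsm : Representation.IsSmooth
      ((rhoVAtLine ↥(maximalRealSubfield (F : Type)) (F : Type) (IsCMField.complexConj (F : Type)) 2
          (finProdFinEquiv : Fin 2 × Fin 1 ≃ Fin (2 * 1)) (Matrix.diagonal dJ)
          (complexConj_imagUnit F) (imagUnit_ne_zero F) (imagUnit_mul_self F) (realDiagonal_isSymm F dJ hdJ)
          (isUnit_det_realDiagonal F dJ hdJ hdJ0) (realDiagonal_map F dJ hdJ).symm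
          (hsChiGS F finProdFinEquiv dJ hdJ hdJ0
            (toHeckeCharacter (F : Type) (galConj (IsCMField.complexConj (F : Type)) μ))
            (isUnitary_toHeckeCharacter (F : Type) (galConj (IsCMField.complexConj (F : Type)) μ))
            ((isOscillatorChar_toHeckeCharacter_iff (galConj (IsCMField.complexConj (F : Type)) μ)).mpr hμ.galConj))
          (r.toFun ε) χ).comp
          (finAdelicCongr ↥(maximalRealSubfield (F : Type)) (F : Type) (IsCMField.complexConj (F : Type)) gstar ht hg).symm.toMonoidHom) :=
    fun v => by
      obtain ⟨S, hS, hfixv⟩ := hsmR v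
      exact Representation.isSmoothVector_of_le _ hS fun k hk => hfixv k hk
  -- continuity hypotheses at this frame
  have hcontA : ∀ f ∈ holCotForms₂ ↥(maximalRealSubfield (F : Type)) (F : Type) (IsCMField.complexConj (F : Type)) Jstar
      (IsCMField.complexConj_ne_one (F : Type)) (UnitaryGroup.complexConj_smul_infinitePlace (F : Type)) (cmPlace (F : Type) ι₁) 𝔣,
      Continuous f := fun f hf => continuous_of_mem_holCotForms₂ _ _ _ _ _ _ _ 𝔣 hf
  -- the junction J1′₂, twice (same `μA`)
  obtain ⟨P, w, h, hu, hfin⟩ := exists_discreteAutomorphicRep_not_orthogonal_hasFinComponent (μ := μA) hdisc _ hirr ψ.toLinearMap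
    (fun g w x => by
      show ψ (_) x = ψ w _
      rw [Representation.IntertwiningMap.isIntertwining]
      rfl)
    (fun w => leftInvariant_of_mem_holCotForms₂ (hψv w)) (fun w => hcontA (ψ w) (hψv w))
    (fun h0 => hψ0 (Representation.IntertwiningMap.ext h0))
  obtain ⟨P', w', h', hu', hfin'⟩ := exists_discreteAutomorphicRep_not_orthogonal_hasFinComponent (μ := μA) hdisc _ hirr ψ'.toLinearMap
    (fun g w x => by
      show ψ' (_) x = ψ' w _
      rw [Representation.IntertwiningMap.isIntertwining]
      rfl)
    (fun w => leftInvariant_of_mem_map_conjFun₂ (hψ'v w)) (fun w => continuous_of_mem_map_conjFun₂ _ _ _ _ _ _ _ 𝔣 (hψ'v w))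
    (fun h0 => hψ'0 (Representation.IntertwiningMap.ext h0))
  -- TP⁺: `P` is of type (1,0), `P′` of type (0,1)
  obtain ⟨f₁, hf₁, hf₁L, heq₁⟩ := hTPhol.apply_herm (F : Type) ι₁ Jstar dJ hdJ hdJ0 t ht gstar hg
    (CurveHodgeTypesDisjoint.isHermitian_map_of_formCongr (F : Type) ι₁ Jstar t ht hτt' gstar dJ hdJ hg _) hsig.1 hsig.2 h4 𝔣 μA P (ψ w) (hψv w) h
  obtain ⟨f₂, hf₂, hf₂L, heq₂⟩ := hTPantihol.apply_herm (F : Type) ι₁ Jstar dJ hdJ hdJ0 t ht gstar hg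
    (CurveHodgeTypesDisjoint.isHermitian_map_of_formCongr (F : Type) ι₁ Jstar t ht hτt' gstar dJ hdJ hg _) hsig.1 hsig.2 h4 𝔣 μA P' (ψ' w') (hψ'v w') h'
  have hne₁ : MemLp.toLp (toQuotFun _ f₁) hf₁L ≠ 0 := by
    rw [← heq₁, Submodule.starProjection_apply]
    exact Subtype.coe_ne_coe.mpr (orthogonalProjectionOnto_ne_zero P.space hu)
  have hne₂ : MemLp.toLp (toQuotFun _ f₂) hf₂L ≠ 0 := by
    rw [← heq₂, Submodule.starProjection_apply]
    exact Subtype.coe_ne_coe.mpr (orthogonalProjectionOnto_ne_zero P'.space hu')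
  have hP : ∃ f ∈ holCotForms₂ ↥(maximalRealSubfield (F : Type)) (F : Type) (IsCMField.complexConj (F : Type)) Jstar
      (IsCMField.complexConj_ne_one (F : Type)) (UnitaryGroup.complexConj_smul_infinitePlace (F : Type)) (cmPlace (F : Type) ι₁) 𝔣,
      f ≠ 0 ∧ ∃ hh : MemLp (toQuotFun _ f) 2 μA, MemLp.toLp (toQuotFun _ f) hh ∈ P.space.toSubmodule := by
    refine ⟨f₁, hf₁, ?_, hf₁L, ?_⟩
    · rintro rfl
      exact hne₁ (MemLp.toLp_zero hf₁L)
    · rw [← heq₁]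
      exact Submodule.starProjection_apply_mem _ _
  have hP' : ∃ f ∈ (holCotForms₂ ↥(maximalRealSubfield (F : Type)) (F : Type) (IsCMField.complexConj (F : Type)) Jstar
      (IsCMField.complexConj_ne_one (F : Type)) (UnitaryGroup.complexConj_smul_infinitePlace (F : Type)) (cmPlace (F : Type) ι₁) 𝔣).map
      (conjFun₂ ↥(maximalRealSubfield (F : Type)) (F : Type) (IsCMField.complexConj (F : Type)) Jstar),
      f ≠ 0 ∧ ∃ hh : MemLp (toQuotFun _ f) 2 μA, MemLp.toLp (toQuotFun _ f) hh ∈ P'.space.toSubmodule := by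
    refine ⟨f₂, hf₂, ?_, hf₂L, ?_⟩
    · rintro rfl
      exact hne₂ (MemLp.toLp_zero hf₂L)
    · rw [← heq₂]
      exact Submodule.starProjection_apply_mem _ _
  -- the two SIGNED letters E3₂♮ at the label `λ := galConj c μ` (conjugate symplectic ★ `hμ.galConj`, weight one ★ `HasWeight.galConj_complexConj`),
  -- `(σ, ιV, j) := (ω⋆_lab, (finAdelicCongr g⋆)⁻¹, id)`: the `(1,0)` occurrence `P` gives `e♮ ∈ Φ_λ ↔ adm`, the `(0,1)` occurrence `P′` gives
  -- `e♮ ∈ Φ_λ ↔ ¬ adm` — jointly absurd (only the CONSISTENCY of the two signed clauses is used, never their direction)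
  have hwc : HasWeight (F : Type) (galConj (IsCMField.complexConj (F : Type)) μ) 1 := hw.galConj_complexConj
  have k₁ := hE3hol (F : Type) ι₁ Jstar dJ hdJ hdJ0 t ht gstar hg hsig.1 hsig.2 h4 𝔣 μA finProdFinEquiv
    (galConj (IsCMField.complexConj (F : Type)) μ) hμ.galConj hwc (r.toFun ε) χ _ _ hirr hsm
    ⟨LinearMap.id, fun _ => rfl⟩ (fun _ _ hxy => hxy) P hP hfin
  have k₂ := hE3antihol (F : Type) ι₁ Jstar dJ hdJ hdJ0 t ht gstar hg hsig.1 hsig.2 h4 𝔣 μA finProdFinEquiv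
    (galConj (IsCMField.complexConj (F : Type)) μ) hμ.galConj hwc (r.toFun ε) χ _ _ hirr hsm
    ⟨LinearMap.id, fun _ => rfl⟩ (fun _ _ hxy => hxy) P' hP' hfin'
  exact iff_not_self (k₁.symm.trans k₂)

end Summit.HodgeConjecture.HodgeConjecture.Cruxes.HLiu418.S1BettiSliceExclusionSigned

end
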